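import Summits.Ventures.CertifiedArithmetic.Expansions.Orient2dEstimate
import Mathlib.Tactic.Linarith
import Mathlib.Tactic.Positivity
import Mathlib.Tactic.Ring
import Mathlib.Tactic.NormNum

/-!
# Stage B of ORIENT2D, part 1: the error analysis behind `ccwerrboundB = (2 + 12ε)ε`

NEW WORK in the sense of this development: the algorithm and the constant are Shewchuk's
(`predicates.c`, `orient2dadapt`; Table 1, line B), the error analysis is ours — the paper derives only
line A in print (§4.3 p. 348) and says the other bounds are "determined by similar analysis".

`orient2dadapt` (reached when the stage-A filter of `orient2d` falls through, with the `detsum`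
computed there) forms the block `B = Two_Two_Diff(Two_Product(acx, bcy), Two_Product(acy, bcx))` on the
ROUNDED coordinate differences `x₁ = acx, x₂ = bcy, x₃ = acy, x₄ = bcx`, sets `det = estimate(4, B)`,
`errbound = ccwerrboundB ⊗ detsum`, and returns `det` if `|det| ≥ errbound`.  This file contains:

* `stageB_sign_of_bounds` — the error analysis as an inequality between rationals (`0 < ε ≤ 1/16`).
  With `s = |x₅| + |x₆|` (`x₅ = x₁ ⊗ x₂`, `x₆ = x₃ ⊗ x₄`) and `Σ = x₁x₂ − x₃x₄` (the exact sum of `B`):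
  the true determinant is `t_A = Σ ± (2ε + 3ε² + ε³)s` (each rounded difference is off by `ε`
  relative, so each product by `(2ε + ε²)` of itself, and `|x₁x₂| ≤ (1 + ε)|x₅|`); and `det`
  approximates `Σ` in one of two ways, according to the SHAPE of `B = ⟨B₀, B₁, B₂, B₃⟩` (nonoverlapping,
  `(B₃, B₂)` the output of one TWO-SUM, `det = ((B₀ ⊕ B₁) ⊕ B₂) ⊕ B₃`): if `B₂ ≠ 0` then
  `|B₀ + B₁| < |B₂|`, `|B₀ ⊕ B₁| ≤ |B₂| ≤ ε|B₃|` give `Σ = det ± (ε|det| + 3ε²|B₃|)` with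
  `Σ = B₃ ± 2ε|B₃|`; if `B₂ = 0` the middle rounding is exact and `B₀, B₁` — roundoff terms of
  TWO-TWO-DIFF acting on `x₅, x₆` and the two-product tails — give
  `Σ = det ± (ε|det| + (ε² + 2ε³ + ε⁴ + ε⁵)s)`.  In both cases the passed test `|det| ≥ E` with
  `E = (2ε + 12ε²)S ± ε(2ε + 12ε²)S`, `S = s ± εs` forces `|t_A − Σ| < |Σ|`: the margins are
  `ε²(3 − 43ε + 87ε² − 83ε³ + 24ε⁴)` and `ε²(2 − 33ε + 33ε² − 13ε³)`, positive for `ε ≤ 1/16`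
  (`p ≥ 4`; at `p = 3` both are negative).
* `ccwerrboundB` and its grid, `orient2dDetsum` (the `detsum` of stage A: `detleft ⊕ detright` or
  `(−detleft) ⊖ detright`), `orient2dStageB` (the stage-B test as an `Option`: `some det` = answers,
  `none` = fall through to stage C), and `orient2dStageA_eq_none` (falling through stage A means
  `detleft`, `detright` are nonzero and of one sign).

Part 2 (`Orient2dStageB.lean`) plugs the floating-point facts into the inequality.
References: J. R. Shewchuk, Discrete Comput. Geom. 18 (1997) 305–363, §4.3 (Fig. 21, Table 1) and
`predicates.c` (`orient2d`, `orient2dadapt`, `estimate`) [Shewchuk1997].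
-/

namespace Summit.Ventures.CertifiedArithmetic.Expansions

open Literature.ComputerArithmetic.JeannerodRump2018
open Literature.ComputerArithmetic.BoldoJeannerodMelquiondMuller2023 hiding twoSum twoSum_fst isFloat_twoSum
open Literature.ComputerArithmetic.JoldesMullerPopescu2017 (isFloat_two_zpow abs_fl_le_of_abs_le)
open Literature.ComputerArithmetic.Shewchuk1997

variable {p : ℕ} {emin : ℤ} {fl : ℚ → ℚ}

/-! ## The error analysis (rational inequalities) -/

/-- The product step without the final rounding: from `t₁ = x₁ ± ε|x₁|`, `t₂ = x₂ ± ε|x₂|` it follows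
that `t₁t₂ = x₁x₂ ± (2ε + ε²)|x₁x₂|`. -/
theorem abs_mul_sub_mul_le_of_rel {u t₁ t₂ x₁ x₂ : ℚ} (hu : 0 ≤ u) (h₁ : |t₁ - x₁| ≤ u * |x₁|)
    (h₂ : |t₂ - x₂| ≤ u * |x₂|) : |t₁ * t₂ - x₁ * x₂| ≤ (2 * u + u ^ 2) * |x₁ * x₂| := by
  have ht₂ : |t₂| ≤ (1 + u) * |x₂| := by
    have := abs_sub_abs_le_abs_sub t₂ x₂
    linarith
  have hdec : t₁ * t₂ - x₁ * x₂ = (t₁ - x₁) * t₂ + x₁ * (t₂ - x₂) := by ring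
  rw [hdec]
  calc |(t₁ - x₁) * t₂ + x₁ * (t₂ - x₂)| ≤ |(t₁ - x₁) * t₂| + |x₁ * (t₂ - x₂)| := abs_add_le _ _
    _ = |t₁ - x₁| * |t₂| + |x₁| * |t₂ - x₂| := by rw [abs_mul, abs_mul]
    _ ≤ u * |x₁| * ((1 + u) * |x₂|) + |x₁| * (u * |x₂|) :=
        add_le_add (mul_le_mul h₁ ht₂ (abs_nonneg _) (by positivity))
          (mul_le_mul_of_nonneg_left h₂ (abs_nonneg _))
    _ = (2 * u + u ^ 2) * |x₁ * x₂| := by rw [abs_mul]; ring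

/-- **The sign test of stage B is sound**, as an inequality between rationals.  Let `0 < ε ≤ 1/16`,
`t_i = x_i ± ε|x_i|` (`i = 1..4`), `x₁x₂ = x₅ ± ε|x₅|`, `x₃x₄ = x₆ ± ε|x₆|`, `s = |x₅| + |x₆| > 0`,
`S = s ± εs`, `E = (2ε + 12ε²)S ± ε(2ε + 12ε²)S`, and let the computed `Q` approximate the EXACT
difference `Σ = x₁x₂ − x₃x₄` in one of the two ways the `estimate` of the block `B` does:
either `Σ = Q ± (ε|Q| + 3ε²|b|)` for some `b` with `Σ = b ± 2ε|b|` (the top component), or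
`Σ = Q ± (ε|Q| + (ε² + 2ε³ + ε⁴ + ε⁵)s)`.  If the test `|Q| ≥ E` passes then `Σ` has the sign of the
true determinant `t_A = t₁t₂ − t₃t₄` (strictly, both ways).  Margins at second order: `3ε²` resp. `2ε²`
(exactly: `ε²(3 − 43ε + 87ε² − 83ε³ + 24ε⁴)` and `ε²(2 − 33ε + 33ε² − 13ε³)`, positive for `ε ≤ 1/16`). -/
theorem stageB_sign_of_bounds {u t₁ t₂ t₃ t₄ x₁ x₂ x₃ x₄ x₅ x₆ Q S E b : ℚ} (hu0 : 0 < u)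
    (hu : u ≤ 1 / 16) (h₁ : |t₁ - x₁| ≤ u * |x₁|) (h₂ : |t₂ - x₂| ≤ u * |x₂|)
    (h₃ : |t₃ - x₃| ≤ u * |x₃|) (h₄ : |t₄ - x₄| ≤ u * |x₄|) (h₅ : |x₁ * x₂ - x₅| ≤ u * |x₅|)
    (h₆ : |x₃ * x₄ - x₆| ≤ u * |x₆|)
    (hQ : (|(x₁ * x₂ - x₃ * x₄) - Q| ≤ u * |Q| + 3 * u ^ 2 * |b| ∧
        |(x₁ * x₂ - x₃ * x₄) - b| ≤ 2 * u * |b|) ∨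
      |(x₁ * x₂ - x₃ * x₄) - Q| ≤ u * |Q| + (u ^ 2 + 2 * u ^ 3 + u ^ 4 + u ^ 5) * (|x₅| + |x₆|))
    (hS : |(|x₅| + |x₆|) - S| ≤ u * (|x₅| + |x₆|))
    (hE : |(2 + 12 * u) * u * S - E| ≤ u * ((2 + 12 * u) * u * S)) (hs : 0 < |x₅| + |x₆|)
    (htest : E ≤ |Q|) :
    (0 < x₁ * x₂ - x₃ * x₄ ↔ 0 < t₁ * t₂ - t₃ * t₄) ∧
      (x₁ * x₂ - x₃ * x₄ < 0 ↔ t₁ * t₂ - t₃ * t₄ < 0) := by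
  set s := |x₅| + |x₆| with hs_def
  set A := x₁ * x₂ - x₃ * x₄ with hA_def
  set c := 2 * u + 3 * u ^ 2 + u ^ 3 with hc_def
  set K := (2 + 12 * u) * u with hK_def
  have hK0 : 0 ≤ K := by positivity
  -- `|t_A − Σ| ≤ (2ε + 3ε² + ε³)s`
  have hP5 : |x₁ * x₂| ≤ (1 + u) * |x₅| := by
    have := abs_sub_abs_le_abs_sub (x₁ * x₂) x₅
    linarith
  have hP6 : |x₃ * x₄| ≤ (1 + u) * |x₆| := by
    have := abs_sub_abs_le_abs_sub (x₃ * x₄) x₆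
    linarith
  have e5 : |t₁ * t₂ - x₁ * x₂| ≤ (2 * u + u ^ 2) * ((1 + u) * |x₅|) :=
    (abs_mul_sub_mul_le_of_rel hu0.le h₁ h₂).trans (mul_le_mul_of_nonneg_left hP5 (by positivity))
  have e6 : |t₃ * t₄ - x₃ * x₄| ≤ (2 * u + u ^ 2) * ((1 + u) * |x₆|) :=
    (abs_mul_sub_mul_le_of_rel hu0.le h₃ h₄).trans (mul_le_mul_of_nonneg_left hP6 (by positivity))
  have herr : |(t₁ * t₂ - t₃ * t₄) - A| ≤ c * s := by
    have hdec : (t₁ * t₂ - t₃ * t₄) - A = (t₁ * t₂ - x₁ * x₂) - (t₃ * t₄ - x₃ * x₄) := by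
      rw [hA_def]; ring
    rw [hdec]
    calc |(t₁ * t₂ - x₁ * x₂) - (t₃ * t₄ - x₃ * x₄)|
          ≤ |t₁ * t₂ - x₁ * x₂| + |t₃ * t₄ - x₃ * x₄| := abs_sub _ _
      _ ≤ (2 * u + u ^ 2) * ((1 + u) * |x₅|) + (2 * u + u ^ 2) * ((1 + u) * |x₆|) := add_le_add e5 e6
      _ = c * s := by rw [hc_def, hs_def]; ring
  -- the computed bound: `S ≥ (1 − ε)s`, `E ≥ (1 − ε)KS`, hence `|Q| ≥ (1 − ε)²Ks`
  have hS1 : (1 - u) * s ≤ S := by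
    have := (abs_sub_le_iff.mp hS).1
    linarith
  have hE1 : (1 - u) * (K * S) ≤ E := by
    have h := (abs_sub_le_iff.mp hE).1
    have : (2 + 12 * u) * u * S = K * S := by rw [hK_def]
    rw [this] at h
    linarith
  have h1u : 0 ≤ 1 - u := by linarith
  have hQ1 : (1 - u) ^ 2 * K * s ≤ |Q| := by
    calc (1 - u) ^ 2 * K * s = (1 - u) * (K * ((1 - u) * s)) := by ring
      _ ≤ (1 - u) * (K * S) := mul_le_mul_of_nonneg_left (mul_le_mul_of_nonneg_left hS1 hK0) h1u
      _ ≤ E := hE1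
      _ ≤ |Q| := htest
  have hQ3 : (1 - u) ^ 3 * K * s ≤ (1 - u) * |Q| := by
    have := mul_le_mul_of_nonneg_left hQ1 h1u
    calc (1 - u) ^ 3 * K * s = (1 - u) * ((1 - u) ^ 2 * K * s) := by ring
      _ ≤ (1 - u) * |Q| := this
  -- the lower bound `c·s < |Σ|`, in either case
  have hlow : c * s < |A| := by
    rcases hQ with ⟨hQ', hb'⟩ | hQ'
    · -- top component `b`: `(1 − 2ε)|b| ≤ |Σ|`, `(1 − ε)|Q| ≤ |Σ| + 3ε²|b|`
      have hb1 : (1 - 2 * u) * |b| ≤ |A| := by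
        have := abs_sub_abs_le_abs_sub b A
        rw [abs_sub_comm b A] at this
        linarith
      have hq1 : (1 - u) * |Q| ≤ |A| + 3 * u ^ 2 * |b| := by
        have := abs_sub_abs_le_abs_sub Q A
        rw [abs_sub_comm Q A] at this
        linarith
      have h12u : 0 ≤ 1 - 2 * u := by linarith
      have hm0 : 0 < 1 - 2 * u + 3 * u ^ 2 := by
        have h2 : 0 ≤ u ^ 2 := sq_nonneg u
        linarith
      have hchain : (1 - 2 * u) * ((1 - u) ^ 3 * K * s) ≤ (1 - 2 * u + 3 * u ^ 2) * |A| := by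
        have h3 : 3 * u ^ 2 * ((1 - 2 * u) * |b|) ≤ 3 * u ^ 2 * |A| :=
          mul_le_mul_of_nonneg_left hb1 (by positivity)
        calc (1 - 2 * u) * ((1 - u) ^ 3 * K * s) ≤ (1 - 2 * u) * ((1 - u) * |Q|) :=
              mul_le_mul_of_nonneg_left hQ3 h12u
          _ ≤ (1 - 2 * u) * (|A| + 3 * u ^ 2 * |b|) := mul_le_mul_of_nonneg_left hq1 h12u
          _ = (1 - 2 * u) * |A| + 3 * u ^ 2 * ((1 - 2 * u) * |b|) := by ring
          _ ≤ (1 - 2 * u) * |A| + 3 * u ^ 2 * |A| := by linarith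
          _ = (1 - 2 * u + 3 * u ^ 2) * |A| := by ring
      -- margin `(1 − 2ε)(1 − ε)³K − c(1 − 2ε + 3ε²) = ε²(3 − 43ε + 87ε² − 83ε³ + 24ε⁴) > 0`
      have hpoly : 0 < 3 - 43 * u + 87 * u ^ 2 - 83 * u ^ 3 + 24 * u ^ 4 := by
        have h87 : 0 ≤ u ^ 2 * (87 - 83 * u) :=
          mul_nonneg (sq_nonneg u) (by linarith)
        linarith [h87, pow_nonneg hu0.le 4]
      have hkey : (1 - 2 * u) * ((1 - u) ^ 3 * K) - c * (1 - 2 * u + 3 * u ^ 2) =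
          u ^ 2 * (3 - 43 * u + 87 * u ^ 2 - 83 * u ^ 3 + 24 * u ^ 4) := by
        rw [hK_def, hc_def]; ring
      have hlt : c * (1 - 2 * u + 3 * u ^ 2) < (1 - 2 * u) * ((1 - u) ^ 3 * K) := by
        have := mul_pos (pow_pos hu0 2) hpoly
        rw [← hkey] at this
        linarith
      have : (1 - 2 * u + 3 * u ^ 2) * (c * s) < (1 - 2 * u + 3 * u ^ 2) * |A| := by
        calc (1 - 2 * u + 3 * u ^ 2) * (c * s) = c * (1 - 2 * u + 3 * u ^ 2) * s := by ring
          _ < (1 - 2 * u) * ((1 - u) ^ 3 * K) * s := mul_lt_mul_of_pos_right hlt hs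
          _ = (1 - 2 * u) * ((1 - u) ^ 3 * K * s) := by ring
          _ ≤ (1 - 2 * u + 3 * u ^ 2) * |A| := hchain
      exact lt_of_mul_lt_mul_left this hm0.le
    · -- all low components below `s`: `(1 − ε)|Q| ≤ |Σ| + (ε² + 2ε³ + ε⁴ + ε⁵)s`
      have hq1 : (1 - u) * |Q| ≤ |A| + (u ^ 2 + 2 * u ^ 3 + u ^ 4 + u ^ 5) * s := by
        have := abs_sub_abs_le_abs_sub Q A
        rw [abs_sub_comm Q A] at this
        linarith
      -- margin `(1 − ε)³K − (ε² + 2ε³ + ε⁴ + ε⁵) − c = ε²(2 − 33ε + 33ε² − 13ε³) > 0` on `ε ≤ 1/16`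
      have hpoly : 0 < 2 - 33 * u + 33 * u ^ 2 - 13 * u ^ 3 := by
        have hr : 0 ≤ 7933 / 256 - 515 / 16 * u + 13 * u ^ 2 := by
          have h2 : 0 ≤ u ^ 2 := sq_nonneg u
          linarith
        have hprod := mul_nonneg (sub_nonneg.mpr hu) hr
        have hid : 2 - 33 * u + 33 * u ^ 2 - 13 * u ^ 3 =
            259 / 4096 + (1 / 16 - u) * (7933 / 256 - 515 / 16 * u + 13 * u ^ 2) := by ring
        rw [hid]
        linarith
      have hkey : (1 - u) ^ 3 * K - (u ^ 2 + 2 * u ^ 3 + u ^ 4 + u ^ 5) - c =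
          u ^ 2 * (2 - 33 * u + 33 * u ^ 2 - 13 * u ^ 3) := by
        rw [hK_def, hc_def]; ring
      have hlt : c + (u ^ 2 + 2 * u ^ 3 + u ^ 4 + u ^ 5) < (1 - u) ^ 3 * K := by
        have := mul_pos (pow_pos hu0 2) hpoly
        rw [← hkey] at this
        linarith
      have := mul_lt_mul_of_pos_right hlt hs
      linarith [this, hQ3, hq1]
  have hstrict : |(t₁ * t₂ - t₃ * t₄) - A| < |A| := lt_of_le_of_lt herr hlow
  -- sign conclusions
  obtain ⟨hl, hr⟩ := abs_sub_lt_iff.mp hstrict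
  constructor
  · constructor
    · intro hApos
      rw [abs_of_pos hApos] at hr
      linarith
    · intro htpos
      by_contra hle
      push Not at hle
      rcases hle.lt_or_eq with hneg | hzero
      · rw [abs_of_neg hneg] at hl
        linarith
      · rw [hzero, abs_zero] at hstrict
        exact absurd hstrict (not_lt.mpr (abs_nonneg _))
  · constructor
    · intro hAneg
      rw [abs_of_neg hAneg] at hl
      linarith
    · intro htneg
      by_contra hle
      push Not at hle
      rcases hle.lt_or_eq with hpos | hzero
      · rw [abs_of_pos hpos] at hr
        linarith
      · rw [← hzero, abs_zero] at hstrict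
        exact absurd hstrict (not_lt.mpr (abs_nonneg _))

/-! ## Stage B of `orient2dadapt` -/

/-- The coefficient `ccwerrboundB = (2 + 12ε)ε` of Table 1, line B (`ε = 2^−p`; `predicates.c`
`exactinit`: `ccwerrboundB = (2.0 + 12.0 * epsilon) * epsilon`, computed exactly). -/
def ccwerrboundB (p : ℕ) : ℚ := (2 + 12 * unitRoundoff p) * unitRoundoff p

/-- `ccwerrboundB = (2·2^p + 12)·2^(−2p)` lies on the grid `2^(−2p) ℤ`. -/
theorem onGrid_ccwerrboundB (p : ℕ) : OnGrid (-(2 * (p : ℤ))) (ccwerrboundB p) := by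
  refine ⟨2 * 2 ^ p + 12, ?_⟩
  unfold ccwerrboundB unitRoundoff
  have h2 : (2 : ℚ) ^ p ≠ 0 := pow_ne_zero _ (by norm_num)
  rw [show (-(2 * (p : ℤ))) = -((p : ℤ) + (p : ℤ)) by ring, zpow_neg, zpow_add₀ (by norm_num),
    zpow_natCast]
  push_cast
  field_simp

/-- The value `detsum` that `orient2d` hands to `orient2dadapt` when stage A falls through:
`detleft ⊕ detright` if `detleft > 0` (then `detright > 0`), else `(−detleft) ⊖ detright`
(then `detleft, detright < 0`) — an approximation of `|detleft| + |detright|`. -/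
def orient2dDetsum (fl : ℚ → ℚ) (a₁ a₂ b₁ b₂ c₁ c₂ : ℚ) : ℚ :=
  let detleft := fl (fl (a₁ - c₁) * fl (b₂ - c₂))
  let detright := fl (fl (a₂ - c₂) * fl (b₁ - c₁))
  if 0 < detleft then fl (detleft + detright) else fl (-detleft - detright)

/-- `predicates.c`, `orient2dadapt`, stage B: `det = estimate(4, B)` (`orient2dDetB`),
`errbound = ccwerrboundB ⊗ detsum`, and `if ((det >= errbound) || (-det >= errbound)) return det;`.
`some det` = stage B answers; `none` = fall through to stage C.  `K` is the coefficient and `detsum`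
the value inherited from stage A. -/
def orient2dStageB (tp : ℚ → ℚ → ℚ × ℚ) (fl : ℚ → ℚ) (K detsum a₁ a₂ b₁ b₂ c₁ c₂ : ℚ) :
    Option ℚ :=
  let det := orient2dDetB tp fl a₁ a₂ b₁ b₂ c₁ c₂
  if fl (K * detsum) ≤ det ∨ fl (K * detsum) ≤ -det then some det else none

/-- What the fall-through of stage A tells stage B: `detleft` and `detright` are nonzero and of the
same sign (for any coefficient `K`). -/
theorem orient2dStageA_eq_none {K a₁ a₂ b₁ b₂ c₁ c₂ : ℚ}
    (hA : orient2dStageA fl K a₁ a₂ b₁ b₂ c₁ c₂ = none) :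
    (0 < fl (fl (a₁ - c₁) * fl (b₂ - c₂)) ∧ 0 < fl (fl (a₂ - c₂) * fl (b₁ - c₁))) ∨
      (fl (fl (a₁ - c₁) * fl (b₂ - c₂)) < 0 ∧ fl (fl (a₂ - c₂) * fl (b₁ - c₁)) < 0) := by
  unfold orient2dStageA at hA
  simp only [] at hA
  split_ifs at hA with hL hR hT hL' hR' hT'
  · exact Or.inl ⟨hL, not_le.mp hR⟩
  · exact Or.inr ⟨hL', not_le.mp hR'⟩

end Summit.Ventures.CertifiedArithmetic.Expansions
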